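import Summits.HodgeConjecture.CorCM.Zeta7PrimitiveResidueTypes
import Summits.HodgeConjecture.CorCM.Census.DeligneWeilFamilyZeta7
import HarnessLib

/-!
# COR-CM: over `ℚ(ζ₇)` Deligne's Weil classes on products of SIMPLE CM threefolds are divisor classes —
# every constant-sum family of primitive CM types of `ℚ(ζ₇)` is a union of conjugate pairs

Cell `pub-hodgecm2` (COR-CM = stage 2 of the Hodge ladder), seat b27 (gen 21), count-neutral; part 2 of 2 (part 1:
`CorCM/Zeta7PrimitiveResidueTypes`), the COMPLEMENT of the kernel census `CorCM/Census/DeligneWeilFamilyZeta7` (seat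
lit-deligne-3 gen 3: the constant-sum family `{1,2,4}, {1,5,3}, {6,2,3}, {6,5,4}` of CM types of `ℚ(ζ₇)` carries
EXCEPTIONAL Weil classes on `A₀ × A₁ × A₂ × A₃`, while the conjugation-closed family `S₀, −S₀, S₁, −S₁` does not).
NEW as stated (not a published statement), hence under `Summits/`; everything PROVED, theorems only (no definition,
no named fact, no `sorry`).

THE SOURCE CONSTRUCTION.  P. Deligne, *Hodge cycles on abelian varieties*, LNM 900 (1982), **I §5 (c)** (re-edition
pp. 38–39): for a family `(Φ_i)_{1≤i≤d}` of CM types of a CM field `E` with `Σ_i Φ_i = constant`, the space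
`⋀^d_E H¹(⊕_i A_{Φ_i}, ℚ)(d/2)` consists of (absolute) Hodge classes — the WEIL CLASSES; by **Lemma 5.2** (p. 40)
the families that are unions of conjugate pairs `{Φ, Φ̄}` contribute only products of divisor classes.  The tree's
`Literature/AlgebraicGeometry/Deligne1982/WeilClassesCMFamilyDivisorCriterion` proves the dictionary: the Weil line of
`s` lies in `Dᵐ ⊗ ℂ` iff `d(Ψ) = d(Ψ̄)` for every type `Ψ` (`weightClassesAlg_weilWeight_le_divisorClassesSpan_iff`,
`typeCount`), all of them iff the family is conjugation-symmetric
(`iSup_weightClassesAlg_weilWeight_le_divisorClassesSpan`).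

THE THEOREMS (`K = ℚ(ζ₇)`; part 1 supplies: the PRIMITIVE CM types of `K` — those with SIMPLE realisations,
Shimura §8.2 Prop. 26 — have residue set one of the six translates `prim7` of `{1,2,3}`, the imprimitive ones
`{1,2,4}` or `{3,5,6}`; and the three column relations of the `6 × 6` incidence matrix, `primitive_colsum_symmetric'`):

* `typeCount_eq_typeCount_compl_of_isPrimitive` / `_of_isSimple` — for EVERY `m` and every family
  `Ψ : Fin (2m) → CMType ℚ(ζ₇)` of primitive types (resp. with simple realisations) with `Σ_j Ψ_j` constant,
  `d(S) = d(S̄)` for every set `S` of embeddings (index map `j ↦ i(j)`, `resSet Ψ_j = prim7 (i j)`; type counts are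
  fibre cardinalities of `i`, column sums are incidence sums);
* **`iSup_weilLine_le_divisorClassesSpan_of_isSimple`** — for every family `(A_j, ι_j, θ_j)_{j<2m}` of SIMPLE CM
  abelian threefolds realising CM types of `ℚ(ζ₇)` with constant column sums (the hypothesis under which the Weil
  lines are Hodge classes at all), ALL `ℚ(ζ₇)`-Weil lines `H^{2m}(⊕ A_j)_{Δ×{s}}` lie in `Dᵐ(⊕ A_j) ⊗ ℂ`;
* `exists_not_isSimple_of_weilLine_not_le` — contrapositive: an exceptional Weil line over `ℚ(ζ₇)` forces a factor
  `A_j` realising the type `{1,2,4}` or `{3,5,6}` induced from `ℚ(√-7)` (`A_j ~ E³`, `E` an elliptic curve with CM by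
  `ℚ(√-7)`: the Moonen–Zarhin shape `E × B` of exceptional classes in low dimension);
* §5, for the census family `Φ7` of `Census/DeligneWeilFamilyZeta7` (imported BY NAME): `isSimple_Φ7_one/two/three`
  and `not_isSimple_Φ7_zero` — `A₁, A₂, A₃` are simple and `A₀` is not, as the theorem predicts for an exceptional
  family (Shimura §8.2 Prop. 26 both ways, tree theorems `isSimple_of_residues`,
  `not_isSimple_of_isCMTypeRealisation_of_ne`).

## References

* [Deligne1982HodgeCycles] P. Deligne, *Hodge cycles on abelian varieties*, LNM 900 (1982), I §5 (c), Lemma 5.2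
  (re-edition pp. 38–40).
* [Shimura1998] G. Shimura, *Abelian Varieties with Complex Multiplication and Modular Functions* (1998), §8.2
  Prop. 26, §6.2 Thm. 3.
* [MoonenZarhin1999] B. Moonen, Yu. Zarhin, *Hodge classes on abelian varieties of low dimension*, Math. Ann. 315
  (1999) 711–733, §0 (exceptional classes on `E × B`).
* [Gordon1999HodgeAVSurvey] B. B. Gordon, *A survey of the Hodge conjecture for abelian varieties*, 9.2.2, §9.3.
-/

noncomputable section

open CategoryTheory CategoryTheory.Limits NumberField

namespace Summit.HodgeConjecture.CorCM.Zeta7WeilFamily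

open Literature.NumberTheory.ComplexMultiplication
open Literature.AlgebraicGeometry.Motives (AbelianVariety CMType)
open Literature.AlgebraicGeometry.HodgeTheory
open Literature.AlgebraicGeometry.ComplexMultiplication (IsCMTypeRealisation isSimple_iff_isPrimitive
  not_isSimple_of_isCMTypeRealisation_of_ne)
open Literature.AlgebraicGeometry.VanGeemen1994 (hodgeClassSpan)
open Literature.AlgebraicGeometry.Pohlmann1968
open Literature.AlgebraicGeometry.Pohlmann1968.Cyclotomic
open Literature.AlgebraicGeometry.Deligne1982
open Literature.Barriers.HodgeConjecture (divisorClassesSpan)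
open Summit.HodgeConjecture.CorCM.Census.DeligneWeilFamilyZeta7 (S7 Φ7)

/-! ### §3 Constant-sum families of primitive types of `ℚ(ζ₇)` are conjugation-symmetric -/

section Symmetric

variable {L : Type} [Field L] [NumberField L] [IsCyclotomicExtension {7} ℚ L] {m : ℕ}

/-- **Main combinatorial theorem.**  Let `Ψ : Fin (2m) → CMType ℚ(ζ₇)` be a family whose members all have residue
set among the primitive ones (`prim7`) and with CONSTANT column sums `#{j | t ∈ Ψ_j} = m` (Deligne's
`Σ Ψ_j = constant`).  Then `d(S) = d(S̄)` for every set `S` of embeddings: the family is a union of conjugate pairs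
in Deligne's sense (Lemma 5.2).  Proof: index map `j ↦ i(j)` with `resSet Ψ_j = prim7 (i j)`; type counts are fibre
cardinalities of `i`, column sums are incidence sums, and `primitive_colsum_symmetric'` applies.
[cite: Deligne1982HodgeCycles, I §5 (c) and Lemma 5.2 (pp. 38–40)] -/
theorem typeCount_eq_typeCount_compl_of_prim7 (Ψ : Fin (2 * m) → CMType L)
    (hP : ∀ j, ∃ i : Fin 6, prim7 i = resSet L (Ψ j))
    (hsum : ∀ t : L →+* ℂ, {j : Fin (2 * m) | t ∈ (Ψ j).1}.ncard = m) (S : Set (L →+* ℂ)) :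
    typeCount Ψ S = typeCount Ψ Sᶜ := by
  classical
  choose idx hidx using hP
  -- equality and conjugacy of members, read on the indices
  have hset : ∀ j j', (Ψ j).1 = (Ψ j').1 ↔ idx j = idx j' := by
    intro j j'
    rw [carrier_eq_iff_resSet_eq, ← hidx j, ← hidx j']
    exact ⟨fun h => prim7_injective h, fun h => by rw [h]⟩
  have hcompl : ∀ j j', (Ψ j).1 = ((Ψ j').1)ᶜ ↔ idx j = conj6 (idx j') := by
    intro j j'
    rw [carrier_eq_compl_iff_resSet_eq, ← hidx j, ← hidx j', ← prim7_conj6]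
    exact ⟨fun h => prim7_injective h, fun h => by rw [h]⟩
  -- type counts as fibre cardinalities of the index map
  have hcount : ∀ j₀, typeCount Ψ (Ψ j₀).1 =
      (Finset.univ.filter fun j : Fin (2 * m) => idx j = idx j₀).card := by
    intro j₀
    rw [typeCount, ncard_setOf_fin_eq_card_filter]
    congr 1
    ext j
    simp only [Finset.mem_filter, Finset.mem_univ, true_and, hset]
  have hcountc : ∀ j₀, typeCount Ψ ((Ψ j₀).1)ᶜ =
      (Finset.univ.filter fun j : Fin (2 * m) => idx j = conj6 (idx j₀)).card := by
    intro j₀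
    rw [typeCount, ncard_setOf_fin_eq_card_filter]
    congr 1
    ext j
    simp only [Finset.mem_filter, Finset.mem_univ, true_and, hcompl]
  -- column sums as incidence sums of the multiplicities
  have hcol : ∀ c ∈ units7, ∑ i ∈ Finset.univ.filter (fun i => c ∈ prim7 i),
      (Finset.univ.filter fun j : Fin (2 * m) => idx j = i).card = m := by
    intro c hc
    obtain ⟨σ, rfl⟩ := exists_expOf_eq 7 L c ((coprime_seven_iff_mem_units7 c).2 hc)
    have h1 : (Finset.univ.filter fun j : Fin (2 * m) => expOf 7 L σ ∈ prim7 (idx j)).card = m := by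
      have hset' : {j : Fin (2 * m) | σ ∈ (Ψ j).1} = {j | expOf 7 L σ ∈ prim7 (idx j)} := by
        ext j
        simp only [Set.mem_setOf_eq, hidx, mem_resSet_iff]
      have h := hsum σ
      rw [hset', ncard_setOf_fin_eq_card_filter] at h
      exact h
    rw [Finset.card_eq_sum_card_fiberwise (f := idx)
      (s := Finset.univ.filter fun j : Fin (2 * m) => expOf 7 L σ ∈ prim7 (idx j))
      (t := Finset.univ.filter fun i : Fin 6 => expOf 7 L σ ∈ prim7 i)
      (fun j hj => Finset.mem_filter.2
        ⟨Finset.mem_univ _, (Finset.mem_filter.1 (Finset.mem_coe.1 hj)).2⟩)] at h1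
    refine Eq.trans (Finset.sum_congr rfl fun i hi => ?_) h1
    have hi' : expOf 7 L σ ∈ prim7 i := (Finset.mem_filter.1 hi).2
    congr 1
    ext j
    simp only [Finset.mem_filter, Finset.mem_univ, true_and]
    exact ⟨fun h => ⟨by rw [h]; exact hi', h⟩, fun h => h.2⟩
  have hconj : ∀ i, (Finset.univ.filter fun j : Fin (2 * m) => idx j = i).card =
      (Finset.univ.filter fun j : Fin (2 * m) => idx j = conj6 i).card := fun i =>
    primitive_colsum_symmetric' (fun i => (Finset.univ.filter fun j : Fin (2 * m) => idx j = i).card)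
      (fun c hc c' hc' => by rw [hcol c hc, hcol c' hc']) i
  -- the three cases for `S`
  by_cases h1 : ∃ j₀, (Ψ j₀).1 = S
  · obtain ⟨j₀, rfl⟩ := h1
    rw [hcount, hcountc]
    exact hconj _
  by_cases h2 : ∃ j₀, (Ψ j₀).1 = Sᶜ
  · obtain ⟨j₀, hj₀⟩ := h2
    have hS : S = ((Ψ j₀).1)ᶜ := by rw [hj₀, compl_compl]
    rw [hS, compl_compl, hcountc, hcount]
    exact (hconj _).symm
  · push Not at h1 h2
    have e1 : {j : Fin (2 * m) | (Ψ j).1 = S} = ∅ := Set.eq_empty_iff_forall_notMem.2 h1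
    have e2 : {j : Fin (2 * m) | (Ψ j).1 = Sᶜ} = ∅ := Set.eq_empty_iff_forall_notMem.2 h2
    rw [typeCount, typeCount, e1, e2]

/-- **Constant-sum families of PRIMITIVE CM types of `ℚ(ζ₇)` are conjugation-symmetric**: `d(S) = d(S̄)` for all
`S`. [cite: Deligne1982HodgeCycles, I §5 (c) and Lemma 5.2 (pp. 38–40)] [cite: Shimura1998, §8.2 Prop. 26] -/
theorem typeCount_eq_typeCount_compl_of_isPrimitive (Ψ : Fin (2 * m) → CMType L)
    (hP : ∀ j, ∃ φ₀ : L →+* ℂ, IsPrimitive (ℂ ≃+* ℂ) (Ψ j).1 φ₀)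
    (hsum : ∀ t : L →+* ℂ, {j : Fin (2 * m) | t ∈ (Ψ j).1}.ncard = m) (S : Set (L →+* ℂ)) :
    typeCount Ψ S = typeCount Ψ Sᶜ :=
  typeCount_eq_typeCount_compl_of_prim7 Ψ
    (fun j => (hP j).elim fun φ₀ h => exists_prim7_eq_resSet_of_isPrimitive L (Ψ j) φ₀ h) hsum S

end Symmetric

/-! ### §4 Geometry: Weil classes on products of SIMPLE CM threefolds with CM by `ℚ(ζ₇)` are divisor classes -/

section Geometry

variable {L : Type} [Field L] [NumberField L] [IsCyclotomicExtension {7} ℚ L] {m : ℕ}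
variable {Ψ : Fin (2 * m) → CMType L} {A : Fin (2 * m) → AbelianVariety ℂ} {ι : ∀ j, 𝓞 L →+* End (A j)}
  {θ : ∀ j, L →+* Module.End ℂ (complexBetti (A j).X 1)}

/-- **For SIMPLE factors every type count is symmetric** (`A_j` simple ⟺ `Ψ_j` primitive, Shimura §8.2 Prop. 26).
[cite: Shimura1998, §8.2 Prop. 26] [cite: Deligne1982HodgeCycles, I §5 (c) and Lemma 5.2 (pp. 38–40)] -/
theorem typeCount_eq_typeCount_compl_of_isSimple (hA : ∀ j, IsCMTypeRealisation (Ψ j) (A j) (ι j) (θ j))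
    (hS : ∀ j, (A j).IsSimple) (hsum : ∀ t : L →+* ℂ, {j : Fin (2 * m) | t ∈ (Ψ j).1}.ncard = m)
    (S : Set (L →+* ℂ)) : typeCount Ψ S = typeCount Ψ Sᶜ :=
  typeCount_eq_typeCount_compl_of_prim7 Ψ (fun j => exists_prim7_eq_resSet_of_isSimple L (Ψ j) (hA j) (hS j))
    hsum S

/-- **MAIN THEOREM.  Over `ℚ(ζ₇)`, Deligne's Weil classes on a product of SIMPLE CM threefolds are divisor
classes**: for every `m`, every constant-sum family `Ψ : Fin (2m) → CMType ℚ(ζ₇)` and every family of SIMPLE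
realisations `(A_j, ι_j, θ_j)`, all the `ℚ(ζ₇)`-Weil lines `H^{2m}(⊕_j A_j)_{Δ×{s}}` lie in `Dᵐ(⊕_j A_j) ⊗ ℂ`, the span
of `m`-fold products of rational `(1,1)` classes (Lemma 5.2: `⊕ A_j ≅ ∏ (A_Φ × A_Φ̄)^{d(Φ)}` up to the CM structure).
[cite: Deligne1982HodgeCycles, I §5 (c) and Lemma 5.2 (pp. 38–40)] [cite: Shimura1998, §8.2 Prop. 26] -/
theorem iSup_weilLine_le_divisorClassesSpan_of_isSimple (hA : ∀ j, IsCMTypeRealisation (Ψ j) (A j) (ι j) (θ j))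
    (hS : ∀ j, (A j).IsSimple) (hsum : ∀ t : L →+* ℂ, {j : Fin (2 * m) | t ∈ (Ψ j).1}.ncard = m) :
    ⨆ s : L →+* ℂ, weightClassesAlg (K := fun _ : Fin (2 * m) => L) A ι (2 * m) (weilWeight m s) ≤
      divisorClassesSpan (⨁ A).X (⨁ A).dim m :=
  iSup_weightClassesAlg_weilWeight_le_divisorClassesSpan hA (typeCount_eq_typeCount_compl_of_isSimple hA hS hsum)

/-- The same for PRIMITIVE types (group-theoretic hypothesis instead of simplicity).
[cite: Deligne1982HodgeCycles, I §5 (c) and Lemma 5.2 (pp. 38–40)] [cite: Shimura1998, §8.2 Prop. 26] -/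
theorem iSup_weilLine_le_divisorClassesSpan_of_isPrimitive (hA : ∀ j, IsCMTypeRealisation (Ψ j) (A j) (ι j) (θ j))
    (hP : ∀ j, ∃ φ₀ : L →+* ℂ, IsPrimitive (ℂ ≃+* ℂ) (Ψ j).1 φ₀)
    (hsum : ∀ t : L →+* ℂ, {j : Fin (2 * m) | t ∈ (Ψ j).1}.ncard = m) :
    ⨆ s : L →+* ℂ, weightClassesAlg (K := fun _ : Fin (2 * m) => L) A ι (2 * m) (weilWeight m s) ≤
      divisorClassesSpan (⨁ A).X (⨁ A).dim m :=
  iSup_weightClassesAlg_weilWeight_le_divisorClassesSpan hA (typeCount_eq_typeCount_compl_of_isPrimitive Ψ hP hsum)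

/-- Under the same hypotheses each Weil line is a line of HODGE classes inside the divisor ring: in `Bᵐ ⊗ ℂ`
(constant sums) and in `Dᵐ ⊗ ℂ`. [cite: Deligne1982HodgeCycles, I §5 (c) (pp. 38–39) and Prop. 4.4] -/
theorem weilLine_le_hodgeClassSpan_inf_divisorClassesSpan_of_isSimple
    (hA : ∀ j, IsCMTypeRealisation (Ψ j) (A j) (ι j) (θ j)) (hS : ∀ j, (A j).IsSimple)
    (hsum : ∀ t : L →+* ℂ, {j : Fin (2 * m) | t ∈ (Ψ j).1}.ncard = m) (s : L →+* ℂ) :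
    weightClassesAlg (K := fun _ : Fin (2 * m) => L) A ι (2 * m) (weilWeight m s) ≤
      hodgeClassSpan (⨁ A).dim (⨁ A).X m ⊓ divisorClassesSpan (⨁ A).X (⨁ A).dim m :=
  le_inf (weightClassesAlg_weilWeight_le_hodgeClassSpan hA hsum s)
    ((weightClassesAlg_weilWeight_le_divisorClassesSpan_iff hA s).2
      (typeCount_eq_typeCount_compl_of_isSimple hA hS hsum))

/-- **Contrapositive: an exceptional Weil line over `ℚ(ζ₇)` forces a non-simple factor** — if for a constant-sum
family some `ℚ(ζ₇)`-Weil line of `⊕_j A_j` is NOT in `Dᵐ ⊗ ℂ` (as for the census family of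
`Census/DeligneWeilFamilyZeta7`), then some `A_j` is not simple and realises the imprimitive type with residue set `{1,2,4}` or `{3,5,6}` (induced
from `ℚ(√-7)`: `A_j ~ E³` with `E` an elliptic curve with CM by `ℚ(√-7)` — the Moonen–Zarhin shape `E × B`).
[cite: MoonenZarhin1999, §0] [cite: Shimura1998, §8.2 Prop. 26 and §6.2 Thm. 3] -/
theorem exists_not_isSimple_of_weilLine_not_le (hA : ∀ j, IsCMTypeRealisation (Ψ j) (A j) (ι j) (θ j))
    (hsum : ∀ t : L →+* ℂ, {j : Fin (2 * m) | t ∈ (Ψ j).1}.ncard = m) {s : L →+* ℂ}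
    (hs : ¬ weightClassesAlg (K := fun _ : Fin (2 * m) => L) A ι (2 * m) (weilWeight m s) ≤
      divisorClassesSpan (⨁ A).X (⨁ A).dim m) :
    ∃ j, ¬ (A j).IsSimple ∧ (resSet L (Ψ j) = {1, 2, 4} ∨ resSet L (Ψ j) = {3, 5, 6}) := by
  by_contra h
  push Not at h
  have h' : ∀ j, (A j).IsSimple := fun j => by
    by_contra hj
    obtain ⟨h₁, h₂⟩ := h j hj
    exact (resSet_eq_squares_or_of_not_isSimple L (Ψ j) (hA j) hj).elim h₁ h₂
  exact hs ((weightClassesAlg_weilWeight_le_divisorClassesSpan_iff hA s).2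
    (typeCount_eq_typeCount_compl_of_isSimple hA h' hsum))

end Geometry

/-! ### §5 The census family `Φ7` of `Census/DeligneWeilFamilyZeta7`: `A₁, A₂, A₃` simple, `A₀` not -/

section Census

/-- The translates of `S₁ = {1,5,3}` separate the units (primitive). [cite: Shimura1998, §8.2 Prop. 26] -/
theorem S7_one_sep : ∀ a ∈ units7, ∀ b ∈ units7, (∀ u ∈ units7, (u * a ∈ S7 1 ↔ u * b ∈ S7 1)) → a = b := by
  decide

/-- The translates of `S₂ = {6,2,3}` separate the units (primitive). [cite: Shimura1998, §8.2 Prop. 26] -/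
theorem S7_two_sep : ∀ a ∈ units7, ∀ b ∈ units7, (∀ u ∈ units7, (u * a ∈ S7 2 ↔ u * b ∈ S7 2)) → a = b := by
  decide

/-- The translates of `S₃ = {6,5,4}` separate the units (primitive). [cite: Shimura1998, §8.2 Prop. 26] -/
theorem S7_three_sep : ∀ a ∈ units7, ∀ b ∈ units7, (∀ u ∈ units7, (u * a ∈ S7 3 ↔ u * b ∈ S7 3)) → a = b := by
  decide

/-- `S₀ = {1,2,4}` is stable under `×2`: its translates do NOT separate `1` and `2` (imprimitive, induced from
`ℚ(√-7)`). [cite: Shimura1998, §8.2 Prop. 26] -/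
theorem S7_zero_not_sep : ∀ u ∈ units7, (u * 1 ∈ S7 0 ↔ u * 2 ∈ S7 0) := by decide

variable {L : Type} [Field L] [NumberField L] [IsCyclotomicExtension {7} ℚ L]
variable {A : Fin (2 * 2) → AbelianVariety ℂ} {ι : ∀ j, 𝓞 L →+* End (A j)}
  {θ : ∀ j, L →+* Module.End ℂ (complexBetti (A j).X 1)}

/-- In the census family, `A₁` is SIMPLE. [cite: Shimura1998, §8.2 Prop. 26] -/
theorem isSimple_Φ7_one (hA : ∀ j, IsCMTypeRealisation (Φ7 L j) (A j) (ι j) (θ j)) : (A 1).IsSimple :=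
  isSimple_of_residues units7 coprime_seven_iff_mem_units7 S7_one_sep (hA 1)

/-- In the census family, `A₂` is SIMPLE. [cite: Shimura1998, §8.2 Prop. 26] -/
theorem isSimple_Φ7_two (hA : ∀ j, IsCMTypeRealisation (Φ7 L j) (A j) (ι j) (θ j)) : (A 2).IsSimple :=
  isSimple_of_residues units7 coprime_seven_iff_mem_units7 S7_two_sep (hA 2)

/-- In the census family, `A₃` is SIMPLE. [cite: Shimura1998, §8.2 Prop. 26] -/
theorem isSimple_Φ7_three (hA : ∀ j, IsCMTypeRealisation (Φ7 L j) (A j) (ι j) (θ j)) : (A 3).IsSimple :=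
  isSimple_of_residues units7 coprime_seven_iff_mem_units7 S7_three_sep (hA 3)

/-- **In the census family, `A₀` is NOT simple** (the embeddings `σ₁ ≠ σ₂` have the same pattern `τ ∘ σ ∈ Φ₀`; Shimura
§8.2 Prop. 26, direction "not primitive ⟹ not simple", with §6.2 Thm. 3: `A₀ ~ E³`) — the non-simple factor that
`exists_not_isSimple_of_weilLine_not_le` predicts for the exceptional census family.
[cite: Shimura1998, §8.2 Prop. 26 and §6.2 Thm. 3] -/
theorem not_isSimple_Φ7_zero (hA : ∀ j, IsCMTypeRealisation (Φ7 L j) (A j) (ι j) (θ j)) : ¬ (A 0).IsSimple := by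
  obtain ⟨s, hs⟩ := exists_expOf_eq 7 L 1 (by decide)
  obtain ⟨t, ht⟩ := exists_expOf_eq 7 L 2 (by decide)
  refine not_isSimple_of_isCMTypeRealisation_of_ne (hA 0) (s := s) (t := t) ?_ ?_
  · intro hst
    have h := congrArg (expOf 7 L) hst
    rw [hs, ht] at h
    exact absurd h (by decide)
  · intro τ
    have hu : autExp 7 τ ∈ units7 := (coprime_seven_iff_mem_units7 _).1 (coprime_autExp 7 τ)
    show expOf 7 L ((τ : ℂ →+* ℂ).comp s) ∈ S7 0 ↔ expOf 7 L ((τ : ℂ →+* ℂ).comp t) ∈ S7 0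
    rw [expOf_comp, expOf_comp, hs, ht]
    exact S7_zero_not_sep _ hu

end Census

end Summit.HodgeConjecture.CorCM.Zeta7WeilFamily

end
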